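import Summits.QuantumFields.YangMills.Theorems.BalabanLadderNTStrongCouplingTripleCore
import Summits.QuantumFields.YangMills.Theorems.BalabanLadderNTStrongCouplingPair
import HarnessLib

/-!
# Crux `NT` (stmt-QuantumFields-19353) / seam `UVSeamRec` (stmt-QuantumFields-20043): the three-point ceiling E3-osc
# (`RefPkgT` clause 3) HOLDS AT STRONG COUPLING — format rung, explicit constants

Helper file of the fleet lead prover of crux `NT` (unit `ym-spine-19353-p1`, g6).  Clause 3 of the registered stub
`stub_refpkgT : RefPkgT` (v4T) is the exterior-oscillation ceiling of the conditional THIRD cumulant of the action density,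

  (E3-osc)  `|kerK3_{Q,η}(x,y,z) − kerK3_{Q,η'}(x,y,z)| ≤ C₃ / (min depth)⁴ / (1 + min pairwise separation)⁸`

for every femto cube `Q`, ALL exteriors and all sites of depth `≥ 1`.  This file proves its body at strong coupling
`216 · N · |β| ≤ 1` for EVERY cube, every exterior pair and every triple of sites, from the separation mechanism (M1) of
`…NTStrongCouplingTripleCore` and the depth profile of `…NTStrongCouplingInfluence`:

* `osc_kerK3_le_depth_smallBeta` — (M2) DEPTH: `|kerK3_{Q,η} − kerK3_{Q,η'}|(x,y,z) ≤ 144 M³ S · 2^{−min depth}` (depth profiles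
  of the seven kernel means, `osc_k3_algebra`);
* `osc_kerK3_le_smallBeta` — **E3-osc, exponential form**: `≤ 192 M³ S · 2^{−max(min(⌊‖z−x‖_∞⌋, ⌊‖z−y‖_∞⌋), min depth)}`;
* `e3osc_smallBeta` — **E3-osc in the REGISTERED shape** (`β`-range replaced by `216 N |β| ≤ 1`, no femto restriction):
  `≤ C₃ / (min depth)⁴ / (1 + min(‖y−x‖₂, ‖z−y‖₂, ‖z−x‖₂))⁸` with `C₃ = 192 M³ S · (1944/(log 2)⁴) · (2·6561·264539520/(log 2)⁸)`.

HONEST FRAMING.  A format rung at high temperature for every compact metrisable `G` and every lattice representation; nothing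
at large `β`, nothing about NT, the seam or the gap.

References: Georgii 2011 Def. 1.23, Thm. 8.20; Dobrushin 1970 Thm. 3; Föllmer 1988 Ch. I (2.10); Simon 1979.
-/

set_option autoImplicit false

noncomputable section

open MeasureTheory Filter Topology
open Literature.MathematicalPhysics.QuantumFieldTheory Literature.MathematicalPhysics.QuantumLattice
open Literature.Probability.LatticeModels
open Summit.QuantumFields.YangMills.Cruxes.OSLegsFromFemtoAndGap.DlrCollarTransfer
open Summit.QuantumFields.YangMills.Theorems.OSLegsFromFemtoAndGap.StubLower (norm_le_two_mul_of_forall_abs_le)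

namespace Summit.QuantumFields.YangMills.Cruxes.NT.StrongCoupling

section Main

variable (G : Type) [Group G] [TopologicalSpace G] [IsTopologicalGroup G] [CompactSpace G]
  [MeasurableSpace G] [BorelSpace G] (r : LatticeRep G)

/-- **(M2) Depth decay of the exterior oscillation of the conditional third cumulant.**  For `216 N |β| ≤ 1`, every cube,
ALL exteriors and every triple: `|kerK3_{Q,η} − kerK3_{Q,η'}|(x,y,z) ≤ 144 M³ S · 2^{−min depth}` (depth profiles of the seven
kernel means, `osc_k3_algebra`). [folklore] -/
theorem osc_kerK3_le_depth_smallBeta {β : ℝ} (hβ : 216 * (r.N : ℝ) * |β| ≤ 1) {M : ℝ}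
    (hM : ∀ (w : Fin 4 → ℤ) (U : LGConfig 4 G), |dens G r w U| ≤ M) (c : Fin 4 → ℤ) (b : ℕ) (η η' : LGConfig 4 G)
    (x y z : Fin 4 → ℤ) :
    |kerK3 G r β c b η x y z - kerK3 G r β c b η' x y z| ≤
      144 * M ^ 3 * r.curvature.supp.card * (1 / 2 : ℝ) ^ min (min (depth c b x) (depth c b y)) (depth c b z) := by
  classical
  haveI := r.t2Space
  haveI := r.secondCountableTopology
  have hM0 : 0 ≤ M := (abs_nonneg _).trans (hM 0 fun _ => 1)
  -- the depth profile on the three supports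
  have hprof : ∀ (u : Fin 4 → ℤ) (w : Literature.MathematicalPhysics.QuantumLattice.ZdEdge 4),
      w ∈ (r.curvature.supp.image fun e : Literature.MathematicalPhysics.QuantumLattice.ZdEdge 4 => (e.1 + u, e.2)) →
      min (min (depth c b x) (depth c b y)) (depth c b z) ≤ depth c b u →
        (1 / 2 : ℝ) ^ (depth c b w.1 - 1) ≤ 4 * (1 / 2 : ℝ) ^ min (min (depth c b x) (depth c b y)) (depth c b z) := by
    intro u w hw hu
    have h1 : depth c b u ≤ depth c b w.1 + 1 := by
      refine depth_le_depth_add_one_of_norm_le c b ?_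
      rw [norm_sub_rev]; exact norm_sub_le_one_of_mem_supp_dens G r hw
    calc (1 / 2 : ℝ) ^ (depth c b w.1 - 1) ≤ (1 / 2 : ℝ) ^ (min (min (depth c b x) (depth c b y)) (depth c b z) - 2) :=
          pow_le_pow_of_le_one (by norm_num) (by norm_num) (by omega)
      _ ≤ _ := half_pow_sub_two_le _
  -- sums over unions of supports
  have hsum : ∀ (T : Finset (Literature.MathematicalPhysics.QuantumLattice.ZdEdge 4)) (k : ℕ),
      (∀ w ∈ T, (1 / 2 : ℝ) ^ (depth c b w.1 - 1) ≤ 4 * (1 / 2 : ℝ) ^ min (min (depth c b x) (depth c b y)) (depth c b z)) →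
      T.card ≤ k * r.curvature.supp.card →
      ∑ w ∈ T, (1 / 2 : ℝ) ^ (depth c b w.1 - 1) ≤
        k * (r.curvature.supp.card * (4 * (1 / 2 : ℝ) ^ min (min (depth c b x) (depth c b y)) (depth c b z))) := by
    intro T k hT hcard
    refine (Finset.sum_le_sum hT).trans ?_
    rw [Finset.sum_const, nsmul_eq_mul]
    have hc : (T.card : ℝ) ≤ k * r.curvature.supp.card := by exact_mod_cast hcard
    calc (T.card : ℝ) * (4 * (1 / 2 : ℝ) ^ min (min (depth c b x) (depth c b y)) (depth c b z))
        ≤ (k * r.curvature.supp.card : ℝ) * (4 * (1 / 2 : ℝ) ^ min (min (depth c b x) (depth c b y)) (depth c b z)) :=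
          mul_le_mul_of_nonneg_right hc (by positivity)
      _ = _ := by ring
  set ΔX := r.curvature.supp.image fun e : Literature.MathematicalPhysics.QuantumLattice.ZdEdge 4 => (e.1 + x, e.2) with hΔX
  set ΔY := r.curvature.supp.image fun e : Literature.MathematicalPhysics.QuantumLattice.ZdEdge 4 => (e.1 + y, e.2) with hΔY
  set ΔZ := r.curvature.supp.image fun e : Literature.MathematicalPhysics.QuantumLattice.ZdEdge 4 => (e.1 + z, e.2) with hΔZ
  have hx' : min (min (depth c b x) (depth c b y)) (depth c b z) ≤ depth c b x := (min_le_left _ _).trans (min_le_left _ _)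
  have hy' : min (min (depth c b x) (depth c b y)) (depth c b z) ≤ depth c b y := (min_le_left _ _).trans (min_le_right _ _)
  have hz' : min (min (depth c b x) (depth c b y)) (depth c b z) ≤ depth c b z := min_le_right _ _
  have hpX := fun w hw => hprof x w hw hx'
  have hpY := fun w hw => hprof y w hw hy'
  have hpZ := fun w hw => hprof z w hw hz'
  have hcX := card_supp_dens_le G r x
  have hcY := card_supp_dens_le G r y
  have hcZ := card_supp_dens_le G r z
  have hunion : ∀ {T₁ T₂ : Finset (Literature.MathematicalPhysics.QuantumLattice.ZdEdge 4)} {k₁ k₂ : ℕ},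
      (∀ w ∈ T₁, (1 / 2 : ℝ) ^ (depth c b w.1 - 1) ≤ 4 * (1 / 2 : ℝ) ^ min (min (depth c b x) (depth c b y)) (depth c b z)) →
      (∀ w ∈ T₂, (1 / 2 : ℝ) ^ (depth c b w.1 - 1) ≤ 4 * (1 / 2 : ℝ) ^ min (min (depth c b x) (depth c b y)) (depth c b z)) →
      T₁.card ≤ k₁ * r.curvature.supp.card → T₂.card ≤ k₂ * r.curvature.supp.card →
      (∀ w ∈ T₁ ∪ T₂, (1 / 2 : ℝ) ^ (depth c b w.1 - 1) ≤ 4 * (1 / 2 : ℝ) ^ min (min (depth c b x) (depth c b y)) (depth c b z)) ∧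
        (T₁ ∪ T₂).card ≤ (k₁ + k₂) * r.curvature.supp.card := by
    intro T₁ T₂ k₁ k₂ h₁ h₂ c₁ c₂
    refine ⟨fun w hw => ?_, ?_⟩
    · rcases Finset.mem_union.1 hw with h | h
      exacts [h₁ w h, h₂ w h]
    · calc (T₁ ∪ T₂).card ≤ T₁.card + T₂.card := Finset.card_union_le _ _
        _ ≤ k₁ * r.curvature.supp.card + k₂ * r.curvature.supp.card := add_le_add c₁ c₂
        _ = (k₁ + k₂) * r.curvature.supp.card := by ring
  obtain ⟨hpXY, hcXY⟩ := hunion hpX hpY (by rw [one_mul]; exact hcX) (by rw [one_mul]; exact hcY)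
  obtain ⟨hpXZ, hcXZ⟩ := hunion hpX hpZ (by rw [one_mul]; exact hcX) (by rw [one_mul]; exact hcZ)
  obtain ⟨hpYZ, hcYZ⟩ := hunion hpY hpZ (by rw [one_mul]; exact hcY) (by rw [one_mul]; exact hcZ)
  obtain ⟨hpXYZ, hcXYZ⟩ := hunion hpXY hpZ hcXY (by rw [one_mul]; exact hcZ)
  -- dependence sets of the products
  have hXm := (continuous_dens r x).measurable
  have hYm := (continuous_dens r y).measurable
  have hZm := (continuous_dens r z).measurable
  have hdep2 : ∀ {u v : Fin 4 → ℤ}, DependsOn (fun U => dens G r u U * dens G r v U)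
      (↑((r.curvature.supp.image fun e : Literature.MathematicalPhysics.QuantumLattice.ZdEdge 4 => (e.1 + u, e.2)) ∪
          (r.curvature.supp.image fun e : Literature.MathematicalPhysics.QuantumLattice.ZdEdge 4 => (e.1 + v, e.2))) :
        Set (Literature.MathematicalPhysics.QuantumLattice.ZdEdge 4)) := by
    intro u v U V h
    rw [Finset.coe_union] at h
    show dens G r u U * dens G r v U = dens G r u V * dens G r v V
    rw [dependsOn_dens G r u fun w hw => h w (Or.inl hw), dependsOn_dens G r v fun w hw => h w (Or.inr hw)]
  have hdep3 : DependsOn (fun U => dens G r x U * dens G r y U * dens G r z U)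
      (↑(ΔX ∪ ΔY ∪ ΔZ) : Set (Literature.MathematicalPhysics.QuantumLattice.ZdEdge 4)) := by
    intro U V h
    rw [Finset.coe_union, Finset.coe_union] at h
    show dens G r x U * dens G r y U * dens G r z U = dens G r x V * dens G r y V * dens G r z V
    rw [dependsOn_dens G r x fun w hw => h w (Or.inl (Or.inl hw)), dependsOn_dens G r y fun w hw => h w (Or.inl (Or.inr hw)),
      dependsOn_dens G r z fun w hw => h w (Or.inr hw)]
  have hb2 : ∀ (u v : Fin 4 → ℤ) (U : LGConfig 4 G), |dens G r u U * dens G r v U| ≤ M * M := fun u v U => by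
    rw [abs_mul]; exact mul_le_mul (hM u U) (hM v U) (abs_nonneg _) hM0
  have hb3 : ∀ U, |dens G r x U * dens G r y U * dens G r z U| ≤ M * M * M := fun U => by
    rw [abs_mul]; exact mul_le_mul (hb2 x y U) (hM z U) (abs_nonneg _) (by positivity)
  -- the seven oscillation bounds, chained with the sums
  set P : ℝ := r.curvature.supp.card * (4 * (1 / 2 : ℝ) ^ min (min (depth c b x) (depth c b y)) (depth c b z)) with hP
  have hP0 : 0 ≤ P := by positivity
  have oX := (abs_kerE_sub_kerE_le_depthProfile G r hβ c b η η' hXm (dependsOn_dens G r x) (hM x)).trans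
    (mul_le_mul_of_nonneg_left (hsum _ 1 hpX (by rw [one_mul]; exact hcX)) (by positivity))
  have oY := (abs_kerE_sub_kerE_le_depthProfile G r hβ c b η η' hYm (dependsOn_dens G r y) (hM y)).trans
    (mul_le_mul_of_nonneg_left (hsum _ 1 hpY (by rw [one_mul]; exact hcY)) (by positivity))
  have oZ := (abs_kerE_sub_kerE_le_depthProfile G r hβ c b η η' hZm (dependsOn_dens G r z) (hM z)).trans
    (mul_le_mul_of_nonneg_left (hsum _ 1 hpZ (by rw [one_mul]; exact hcZ)) (by positivity))
  have oXY := (abs_kerE_sub_kerE_le_depthProfile G r hβ c b η η' (hXm.mul hYm) hdep2 (hb2 x y)).trans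
    (mul_le_mul_of_nonneg_left (hsum _ 2 hpXY hcXY) (by positivity))
  have oXZ := (abs_kerE_sub_kerE_le_depthProfile G r hβ c b η η' (hXm.mul hZm) hdep2 (hb2 x z)).trans
    (mul_le_mul_of_nonneg_left (hsum _ 2 hpXZ hcXZ) (by positivity))
  have oYZ := (abs_kerE_sub_kerE_le_depthProfile G r hβ c b η η' (hYm.mul hZm) hdep2 (hb2 y z)).trans
    (mul_le_mul_of_nonneg_left (hsum _ 2 hpYZ hcYZ) (by positivity))
  have oXYZ := (abs_kerE_sub_kerE_le_depthProfile G r hβ c b η η' ((hXm.mul hYm).mul hZm) hdep3 hb3).trans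
    (mul_le_mul_of_nonneg_left (hsum _ 3 hpXYZ hcXYZ) (by positivity))
  have eX' := BoundaryLaw.abs_kerE_le G r β c b η' (hM x)
  have eY := BoundaryLaw.abs_kerE_le G r β c b η (hM y)
  have eY' := BoundaryLaw.abs_kerE_le G r β c b η' (hM y)
  have eZ := BoundaryLaw.abs_kerE_le G r β c b η (hM z)
  have eZ' := BoundaryLaw.abs_kerE_le G r β c b η' (hM z)
  have eXY := BoundaryLaw.abs_kerE_le G r β c b η (hb2 x y)
  have eXZ := BoundaryLaw.abs_kerE_le G r β c b η (hb2 x z)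
  have eYZ := BoundaryLaw.abs_kerE_le G r β c b η (hb2 y z)
  unfold kerK3
  generalize kerE G r β c b η (fun U => dens G r x U * dens G r y U * dens G r z U) = p at oXYZ ⊢
  generalize kerE G r β c b η' (fun U => dens G r x U * dens G r y U * dens G r z U) = p' at oXYZ ⊢
  generalize kerE G r β c b η (dens G r x) = a₁ at oX ⊢
  generalize kerE G r β c b η' (dens G r x) = a₂ at oX eX' ⊢
  generalize kerE G r β c b η (dens G r y) = b₁ at oY eY ⊢
  generalize kerE G r β c b η' (dens G r y) = b₂ at oY eY' ⊢
  generalize kerE G r β c b η (dens G r z) = c₁ at oZ eZ ⊢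
  generalize kerE G r β c b η' (dens G r z) = c₂ at oZ eZ' ⊢
  generalize kerE G r β c b η (fun U => dens G r x U * dens G r y U) = qxy at oXY eXY ⊢
  generalize kerE G r β c b η' (fun U => dens G r x U * dens G r y U) = qxy' at oXY ⊢
  generalize kerE G r β c b η (fun U => dens G r x U * dens G r z U) = qxz at oXZ eXZ ⊢
  generalize kerE G r β c b η' (fun U => dens G r x U * dens G r z U) = qxz' at oXZ ⊢
  generalize kerE G r β c b η (fun U => dens G r y U * dens G r z U) = qyz at oYZ eYZ ⊢
  generalize kerE G r β c b η' (fun U => dens G r y U * dens G r z U) = qyz' at oYZ ⊢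
  have key := osc_k3_algebra (u₁ := 2 * M * (((1 : ℕ) : ℝ) * P)) (u₂ := 2 * (M * M) * (((2 : ℕ) : ℝ) * P))
    (u₃ := 2 * (M * M * M) * (((3 : ℕ) : ℝ) * P)) hM0 (by positivity) oXYZ oX oY oZ oXY oXZ oYZ eX' eY' eZ' eY eZ eXY eXZ eYZ
  refine key.trans (le_of_eq ?_)
  rw [hP]; push_cast; ring

/-- **E3-osc at strong coupling, exponential form**: for `216 N |β| ≤ 1`, every cube, ALL exteriors, every triple,
`|kerK3_{Q,η} − kerK3_{Q,η'}|(x,y,z) ≤ 192 M³ S · 2^{−max(min(⌊‖z−x‖_∞⌋, ⌊‖z−y‖_∞⌋), min depth)}`. [folklore] -/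
theorem osc_kerK3_le_smallBeta {β : ℝ} (hβ : 216 * (r.N : ℝ) * |β| ≤ 1) {M : ℝ}
    (hM : ∀ (w : Fin 4 → ℤ) (U : LGConfig 4 G), |dens G r w U| ≤ M) (c : Fin 4 → ℤ) (b : ℕ) (η η' : LGConfig 4 G)
    (x y z : Fin 4 → ℤ) :
    |kerK3 G r β c b η x y z - kerK3 G r β c b η' x y z| ≤
      192 * M ^ 3 * r.curvature.supp.card *
        (1 / 2 : ℝ) ^ max (min ⌊‖z - x‖⌋₊ ⌊‖z - y‖⌋₊) (min (min (depth c b x) (depth c b y)) (depth c b z)) := by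
  have hM0 : 0 ≤ M := (abs_nonneg _).trans (hM 0 fun _ => 1)
  rcases le_total (min ⌊‖z - x‖⌋₊ ⌊‖z - y‖⌋₊) (min (min (depth c b x) (depth c b y)) (depth c b z)) with h | h
  · rw [max_eq_right h]
    refine (osc_kerK3_le_depth_smallBeta G r hβ hM c b η η' x y z).trans ?_
    have : 0 ≤ M ^ 3 * r.curvature.supp.card *
        (1 / 2 : ℝ) ^ min (min (depth c b x) (depth c b y)) (depth c b z) := by positivity
    nlinarith
  · rw [max_eq_left h]
    have h1 := abs_kerK3_le_smallBeta G r hβ hM c b η x y z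
    have h2 := abs_kerK3_le_smallBeta G r hβ hM c b η' x y z
    calc _ ≤ |kerK3 G r β c b η x y z| + |kerK3 G r β c b η' x y z| := abs_sub _ _
      _ ≤ _ := by linarith

/-- **E3-osc at strong coupling in the REGISTERED shape** (`RefPkgT` clause 3 of crux `NT`, skeleton v4T, with the `β`-range
replaced by `216 N |β| ≤ 1` and the femto restriction dropped): for every cube, ALL exteriors and all triples of sites of
depth `≥ 1`, `|kerK3_{Q,η} − kerK3_{Q,η'}|(x,y,z) ≤ C₃ / (min depth)⁴ / (1 + min pairwise separation)⁸` with the explicit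
`C₃ = 192 M³ S · (1944/(log 2)⁴) · (2 · 6561 · 264539520/(log 2)⁸)`.  FORMAT RUNG; nothing at large `β`. [folklore] -/
theorem e3osc_smallBeta {M : ℝ} (hM : ∀ (w : Fin 4 → ℤ) (U : LGConfig 4 G), |dens G r w U| ≤ M) :
    ∃ C₃ : ℝ, 0 ≤ C₃ ∧ ∀ β : ℝ, 216 * (r.N : ℝ) * |β| ≤ 1 →
      ∀ (c : Fin 4 → ℤ) (b : ℕ) (η η' : LGConfig 4 G) (x y z : Fin 4 → ℤ),
        1 ≤ depth c b x → 1 ≤ depth c b y → 1 ≤ depth c b z →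
        |kerK3 G r β c b η x y z - kerK3 G r β c b η' x y z| ≤
          C₃ / ((min (min (depth c b x) (depth c b y)) (depth c b z) : ℕ) : ℝ) ^ 4 /
            (1 + min (min ‖siteToE (y - x)‖ ‖siteToE (z - y)‖) ‖siteToE (z - x)‖) ^ 8 := by
  have hlog : 0 < Real.log 2 := Real.log_pos (by norm_num)
  have hM0 : 0 ≤ M := (abs_nonneg _).trans (hM 0 fun _ => 1)
  set K₁ : ℝ := 1944 / Real.log 2 ^ 4 with hK₁
  set K₃ : ℝ := 2 * 6561 * 264539520 / Real.log 2 ^ 8 with hK₃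
  refine ⟨192 * M ^ 3 * r.curvature.supp.card * K₁ * K₃, by positivity, fun β hβ c b η η' x y z hx hy hz => ?_⟩
  set dm : ℕ := min (min (depth c b x) (depth c b y)) (depth c b z) with hdm
  set s : ℕ := min ⌊‖z - x‖⌋₊ ⌊‖z - y‖⌋₊ with hs
  set sep : ℝ := min (min ‖siteToE (y - x)‖ ‖siteToE (z - y)‖) ‖siteToE (z - x)‖ with hsep
  have hdm1 : 1 ≤ dm := le_min (le_min hx hy) hz
  have hdpos : (0 : ℝ) < (dm : ℝ) := by exact_mod_cast hdm1
  have hsep0 : 0 ≤ sep := le_min (le_min (norm_nonneg _) (norm_nonneg _)) (norm_nonneg _)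
  have hsep1 : (0 : ℝ) < 1 + sep := by linarith
  refine (osc_kerK3_le_smallBeta G r hβ hM c b η η' x y z).trans ?_
  -- `2^{-max(s, dm)} ≤ 2 · 2^{-⌊(s+1)/2⌋} 2^{-⌊dm/2⌋}`
  have hmax : (s + 1) / 2 + dm / 2 ≤ max s dm + 1 := by omega
  have hpow : (1 / 2 : ℝ) ^ max s dm ≤ 2 * ((1 / 2 : ℝ) ^ ((s + 1) / 2) * (1 / 2 : ℝ) ^ (dm / 2)) := by
    have h1 : (1 / 2 : ℝ) ^ (max s dm + 1) ≤ (1 / 2 : ℝ) ^ ((s + 1) / 2 + dm / 2) :=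
      pow_le_pow_of_le_one (by norm_num) (by norm_num) hmax
    rw [pow_succ, pow_add] at h1
    linarith
  -- separation: `1 + sep ≤ 3 (s + 1)` (the Euclidean min is attained within the two pairs through `z`, up to `ℓ^∞ ≤ ℓ²`)
  have hsx := one_add_norm_siteToE_le x z
  have hsy := one_add_norm_siteToE_le y z
  have hsep3 : 1 + sep ≤ 3 * ((s : ℝ) + 1) := by
    rcases le_total ⌊‖z - x‖⌋₊ ⌊‖z - y‖⌋₊ with h | h
    · have hs' : s = ⌊‖z - x‖⌋₊ := by rw [hs, min_eq_left h]
      have : sep ≤ ‖siteToE (z - x)‖ := min_le_right _ _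
      rw [hs']; linarith
    · have hs' : s = ⌊‖z - y‖⌋₊ := by rw [hs, min_eq_right h]
      have : sep ≤ ‖siteToE (z - y)‖ := (min_le_left _ _).trans (min_le_right _ _)
      rw [hs']; linarith
  have hsep8 : (1 + sep) ^ 8 ≤ 6561 * ((s : ℝ) + 1) ^ 8 := by
    have := pow_le_pow_left₀ hsep1.le hsep3 8; nlinarith
  have hd := half_pow_half_le_quartic hdm1
  have hs1 : 1 ≤ s + 1 := by omega
  have hsq := half_pow_half_le_octic hs1
  have hspos : (0 : ℝ) < (s : ℝ) + 1 := by positivity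
  have hA : (1 / 2 : ℝ) ^ (dm / 2) ≤ K₁ / (dm : ℝ) ^ 4 := by rw [hK₁, div_div]; exact hd
  have hB : 2 * (1 / 2 : ℝ) ^ ((s + 1) / 2) ≤ K₃ / (1 + sep) ^ 8 := by
    have hs' : (1 / 2 : ℝ) ^ ((s + 1) / 2) ≤ 264539520 / (Real.log 2 ^ 8 * ((s : ℝ) + 1) ^ 8) := by
      have := hsq; push_cast at this; exact this
    rw [hK₃, le_div_iff₀ (by positivity)]
    calc 2 * (1 / 2 : ℝ) ^ ((s + 1) / 2) * (1 + sep) ^ 8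
        ≤ 2 * (264539520 / (Real.log 2 ^ 8 * ((s : ℝ) + 1) ^ 8)) * (6561 * ((s : ℝ) + 1) ^ 8) := by gcongr
      _ = 2 * 6561 * 264539520 / Real.log 2 ^ 8 := by field_simp
  have hfinal : (1 / 2 : ℝ) ^ max s dm ≤ K₁ / (dm : ℝ) ^ 4 * (K₃ / (1 + sep) ^ 8) := by
    refine hpow.trans ?_
    calc 2 * ((1 / 2 : ℝ) ^ ((s + 1) / 2) * (1 / 2 : ℝ) ^ (dm / 2))
        = (1 / 2 : ℝ) ^ (dm / 2) * (2 * (1 / 2 : ℝ) ^ ((s + 1) / 2)) := by ring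
      _ ≤ K₁ / (dm : ℝ) ^ 4 * (K₃ / (1 + sep) ^ 8) := mul_le_mul hA hB (by positivity) (by positivity)
  have hC0 : 0 ≤ 192 * M ^ 3 * (r.curvature.supp.card : ℝ) := by positivity
  calc 192 * M ^ 3 * (r.curvature.supp.card : ℝ) * (1 / 2 : ℝ) ^ max s dm
      ≤ 192 * M ^ 3 * (r.curvature.supp.card : ℝ) * (K₁ / (dm : ℝ) ^ 4 * (K₃ / (1 + sep) ^ 8)) :=
        mul_le_mul_of_nonneg_left hfinal hC0
    _ = 192 * M ^ 3 * (r.curvature.supp.card : ℝ) * K₁ * K₃ / (dm : ℝ) ^ 4 / (1 + sep) ^ 8 := by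
        field_simp

/-! ## The ceiling half of `RefPkgT` at strong coupling, one `β`-range -/

/-- **E1-osc by the Dobrushin route, exponential form** (explicit `β`-range): for `216 N |β| ≤ 1`, every cube, ALL
exteriors and every site, `|kerE_{Q,η}(dens x) − kerE_{Q,η'}(dens x)| ≤ 8 M S · 2^{−depth x}` (`abs_kerE_sub_kerE_le_depthProfile`;
the links of `dens x` have depth `≥ depth x − 1`). [folklore] -/
theorem osc_kerE_dens_le_smallBeta_dobrushin {β : ℝ} (hβ : 216 * (r.N : ℝ) * |β| ≤ 1) {M : ℝ}
    (hM : ∀ (w : Fin 4 → ℤ) (U : LGConfig 4 G), |dens G r w U| ≤ M) (c : Fin 4 → ℤ) (b : ℕ) (η η' : LGConfig 4 G)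
    (x : Fin 4 → ℤ) :
    |kerE G r β c b η (dens G r x) - kerE G r β c b η' (dens G r x)| ≤
      8 * M * r.curvature.supp.card * (1 / 2 : ℝ) ^ depth c b x := by
  classical
  haveI := r.t2Space
  haveI := r.secondCountableTopology
  have hM0 : 0 ≤ M := (abs_nonneg _).trans (hM 0 fun _ => 1)
  have h := abs_kerE_sub_kerE_le_depthProfile G r hβ c b η η' (continuous_dens r x).measurable (dependsOn_dens G r x) (hM x)
  have hsum : ∑ w ∈ (r.curvature.supp.image fun e : Literature.MathematicalPhysics.QuantumLattice.ZdEdge 4 => (e.1 + x, e.2)),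
      (1 / 2 : ℝ) ^ (depth c b w.1 - 1) ≤ r.curvature.supp.card * (4 * (1 / 2 : ℝ) ^ depth c b x) := by
    have hterm : ∀ w ∈ (r.curvature.supp.image fun e : Literature.MathematicalPhysics.QuantumLattice.ZdEdge 4 =>
        (e.1 + x, e.2)), (1 / 2 : ℝ) ^ (depth c b w.1 - 1) ≤ 4 * (1 / 2 : ℝ) ^ depth c b x := by
      intro w hw
      have h1 : depth c b x ≤ depth c b w.1 + 1 := by
        refine depth_le_depth_add_one_of_norm_le c b ?_
        rw [norm_sub_rev]; exact norm_sub_le_one_of_mem_supp_dens G r hw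
      calc (1 / 2 : ℝ) ^ (depth c b w.1 - 1) ≤ (1 / 2 : ℝ) ^ (depth c b x - 2) :=
            pow_le_pow_of_le_one (by norm_num) (by norm_num) (by omega)
        _ ≤ _ := half_pow_sub_two_le _
    refine (Finset.sum_le_sum hterm).trans ?_
    rw [Finset.sum_const, nsmul_eq_mul]
    refine mul_le_mul_of_nonneg_right ?_ (by positivity)
    exact_mod_cast card_supp_dens_le G r x
  refine h.trans ?_
  calc 2 * M * ∑ w ∈ (r.curvature.supp.image fun e : Literature.MathematicalPhysics.QuantumLattice.ZdEdge 4 => (e.1 + x, e.2)),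
        (1 / 2 : ℝ) ^ (depth c b w.1 - 1) ≤ 2 * M * (r.curvature.supp.card * (4 * (1 / 2 : ℝ) ^ depth c b x)) :=
        mul_le_mul_of_nonneg_left hsum (by positivity)
    _ = 8 * M * r.curvature.supp.card * (1 / 2 : ℝ) ^ depth c b x := by ring

/-- **E1-osc by the Dobrushin route in the registered quartic shape** (companion of `BoundaryLaw.e1osc_smallBeta`, explicit
`β`-range): for `216 N |β| ≤ 1`, every cube, ALL exteriors and every site of depth `≥ 1`,
`|kerE_{Q,η}(dens x) − kerE_{Q,η'}(dens x)| ≤ (192 M S / (log 2)⁴) / depth⁴`. [folklore] -/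
theorem e1osc_smallBeta_dobrushin {β : ℝ} (hβ : 216 * (r.N : ℝ) * |β| ≤ 1) {M : ℝ}
    (hM : ∀ (w : Fin 4 → ℤ) (U : LGConfig 4 G), |dens G r w U| ≤ M) (c : Fin 4 → ℤ) (b : ℕ) (η η' : LGConfig 4 G)
    (x : Fin 4 → ℤ) (hx : 1 ≤ depth c b x) :
    |kerE G r β c b η (dens G r x) - kerE G r β c b η' (dens G r x)| ≤
      192 * M * r.curvature.supp.card / Real.log 2 ^ 4 / (depth c b x : ℝ) ^ 4 := by
  have hM0 : 0 ≤ M := (abs_nonneg _).trans (hM 0 fun _ => 1)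
  have hlog : 0 < Real.log 2 := Real.log_pos (by norm_num)
  have hd : (0 : ℝ) < (depth c b x : ℝ) := by exact_mod_cast hx
  have hq := BoundaryLaw.half_pow_le_div_pow_four hx
  refine (osc_kerE_dens_le_smallBeta_dobrushin G r hβ hM c b η η' x).trans ?_
  calc 8 * M * r.curvature.supp.card * (1 / 2 : ℝ) ^ depth c b x
      ≤ 8 * M * r.curvature.supp.card * (24 / (Real.log 2 ^ 4 * (depth c b x : ℝ) ^ 4)) :=
        mul_le_mul_of_nonneg_left hq (by positivity)
    _ = 192 * M * r.curvature.supp.card / Real.log 2 ^ 4 / (depth c b x : ℝ) ^ 4 := by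
        field_simp; ring

/-- **The three exterior-oscillation ceilings of `RefPkgT` (clauses 1–3 of the registered stub `stub_refpkgT` of crux `NT`,
skeleton v4T) hold TOGETHER at strong coupling**, in the registered shapes, for every cube (no femto restriction), ALL exteriors
and all sites of depth `≥ 1`, with one `β`-range `216 · N · |β| ≤ 1` and explicit constants — the ceiling half of the
periodic-reference package is inhabited by the lattice Yang–Mills kernels in the high-temperature regime (the floors, clauses
4–5, are statements about `β → ∞` and are not touched).  FORMAT RUNG; nothing at large `β`, nothing about NT or the gap.
[folklore] -/
theorem refPkgT_ceilings_smallBeta :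
    ∃ C₁ C₂ C₃ : ℝ, 0 ≤ C₁ ∧ 0 ≤ C₂ ∧ 0 ≤ C₃ ∧ ∀ β : ℝ, 216 * (r.N : ℝ) * |β| ≤ 1 →
      (∀ (c : Fin 4 → ℤ) (b : ℕ) (η η' : LGConfig 4 G) (x : Fin 4 → ℤ), 1 ≤ depth c b x →
        |kerE G r β c b η (dens G r x) - kerE G r β c b η' (dens G r x)| ≤ C₁ / (depth c b x : ℝ) ^ 4) ∧
      (∀ (c : Fin 4 → ℤ) (b : ℕ) (η η' : LGConfig 4 G) (x y : Fin 4 → ℤ), 1 ≤ depth c b x → 1 ≤ depth c b y →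
        |kerCov G r β c b η (dens G r x) (dens G r y) - kerCov G r β c b η' (dens G r x) (dens G r y)| ≤
          C₂ / ((min (depth c b x) (depth c b y) : ℕ) : ℝ) ^ 4 / (1 + ‖siteToE (y - x)‖) ^ 4) ∧
      (∀ (c : Fin 4 → ℤ) (b : ℕ) (η η' : LGConfig 4 G) (x y z : Fin 4 → ℤ),
        1 ≤ depth c b x → 1 ≤ depth c b y → 1 ≤ depth c b z →
        |kerK3 G r β c b η x y z - kerK3 G r β c b η' x y z| ≤
          C₃ / ((min (min (depth c b x) (depth c b y)) (depth c b z) : ℕ) : ℝ) ^ 4 /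
            (1 + min (min ‖siteToE (y - x)‖ ‖siteToE (z - y)‖) ‖siteToE (z - x)‖) ^ 8) := by
  obtain ⟨M, hM0, hM⟩ := StubLower.exists_abs_dens_le G r
  obtain ⟨C₂, hC₂, h₂⟩ := e2osc_smallBeta G r hM
  obtain ⟨C₃, hC₃, h₃⟩ := e3osc_smallBeta G r hM
  have hlog : 0 < Real.log 2 := Real.log_pos (by norm_num)
  refine ⟨192 * M * r.curvature.supp.card / Real.log 2 ^ 4, C₂, C₃, by positivity, hC₂, hC₃, fun β hβ => ⟨?_, h₂ β hβ, h₃ β hβ⟩⟩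
  intro c b η η' x hx
  exact e1osc_smallBeta_dobrushin G r hβ hM c b η η' x hx

end Main

end Summit.QuantumFields.YangMills.Cruxes.NT.StrongCoupling

end
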